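import Summits.QuantumFields.YangMills.Theorems.UnitScaleGibbsNormalEquationNetFlux
import HarnessLib

/-!
# `UnitScaleGibbsTorusLeastSquaresPotential` — THE GLOBAL (TORUS) LEAST-SQUARES POTENTIAL OF A PLAQUETTE WEIGHT
# (the normal equations `∀ B, Σ_p ((dv)_p − w_p)·(dB)_p = 0` ARE inhabited — by a torus-wide `v`; companion to the NET-FLUX obstruction)

Cell `ym3-torus` (YM ladder rung R3 = continuum SU(2) Yang–Mills on every three-torus — a RUNG, NOT d = 4, NOT infinite volume, NOT a mass gap,
NOT the Clay problem), crux of record `UnitScaleTilt.HistoryTailL` (stmt-QuantumFields-19936), width seat `ym-ust-19936-w5` gen 16; LINE 28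
«GrossTransfer» is registered on stmt-QuantumFields-23083.  ✓`UnitScaleGibbsNormalEquationNetFlux(LinWeight)` proved that NO bond field with BOX-supported
curl satisfies the least-squares normal equations against a net-flux weight (`linWeight j a`: net flux `(L·L)^j`).  THIS FILE records the other half of
the picture, the one Gross's U(1) argument actually uses [GrossCMP1983, Thm 2.2 with a GLOBAL test form]: on the WHOLE torus the normal equations are
solvable for EVERY weight — the orthogonal projection of `w` onto the exact 2-forms `{dv}`:

* ★ `exists_torus_leastSquares_potential (w)`: there is `v : PBond P j → ℝ` with `∀ B, Σ_p ((dv)_p − w_p)·(dB)_p = 0` (the `hN` letters of (LIN-ID) v1,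
  token for token) and the energy bound `Σ_p (dv)_p² ≤ Σ_p w_p²`;
* `sum_curl_mul_curl_eq_sum_mul_curl`, `sum_sq_sub_eq`: under the normal equations `Σ (dv)² = Σ w·(dv)` and `Σ (w − dv)² = Σ w² − Σ (dv)²` (Pythagoras);
* ★ `sum_ite_sub_curl_eq` (with ✓`sum_ite_curl_eq_zero`): the residual `r = w − dv` carries the WHOLE net flux of `w` through every orientation,
  `Σ_{p ∥ (μ,ν)} (w − dv)_p = Σ_{p ∥ (μ,ν)} w_p` — «the return circulation goes to infinity»: it sits in the coexact-plus-harmonic part of `w`,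
  which a box cannot hold (the NET-FLUX theorem) but the torus can;
* `exists_torus_leastSquares_potential_pi`: the componentwise (vector-valued) form.

WHAT THIS IS (AND IS NOT).  Finite-dimensional linear algebra (Mathlib `Submodule.starProjection` onto `LinearMap.range` of the curl map in
`EuclideanSpace`); the SUPPORT of `v` is the whole torus and NO decay / mass profile of `v` is claimed here (the dipole law `|v| ≍ (L²)^j / r²` off the
source, which any global-test-field variant of LINE 28 must budget in its Hessian, is discrete potential theory NOT done in this file).  Proves no stub,
closes no item; nothing of `stub_linTest`, «ShallowFluxSecondMomentL», (Q), 23083/23133/23134, K1 or `HistoryTailL` is proved.  YM₃ on T³ is rung R3 —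
NOT d = 4, NOT infinite volume, NOT a mass gap, NOT the Clay problem.

References: L. Gross, CMP **92** (1983) 137–162 [GrossCMP1983] (Thm 2.2; the test form `h` with `dh` = exact part of the flux weight);
T. Bałaban, CMP **96** (1984) 223–250 [Balaban1984PropagatorsII] ((2.121)–(2.123): least squares in the axial gauge, the box version ✓p733604).
-/

set_option autoImplicit false

noncomputable section

open scoped BigOperators RealInnerProductSpace
open Literature.MathematicalPhysics.QuantumFieldTheory.Balaban1983to89
open Summit.QuantumFields.YangMills.Theorems.UnitScaleGibbsActionDerivativeSlotCalculus (slotBond)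
open Summit.QuantumFields.YangMills.Theorems.UnitScaleGibbsNormalEquationNetFlux (sum_ite_curl_eq_zero)

namespace Summit.QuantumFields.YangMills.Theorems.UnitScaleGibbsTorusLeastSquaresPotential

variable {P : Params} {j : ℕ}

/-- ★ **THE TORUS LEAST-SQUARES POTENTIAL.**  For every real plaquette weight `w` on `T^{(j)}` there is a bond field `v` whose curl is the orthogonal
projection of `w` onto the exact 2-forms: the NORMAL EQUATIONS `∀ B, Σ_p ((dv)_p − w_p)·(dB)_p = 0` hold against EVERY bond field `B` (the `hN` letters),
and `Σ_p (dv)_p² ≤ Σ_p w_p²`.  (Global support: by ✓`not_normalEq_of_orientationSum_ne_zero` no `v` with box-supported curl can do this for a net-flux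
`w`.) [cite: GrossCMP1983, Thm 2.2] -/
theorem exists_torus_leastSquares_potential (w : Plaq P j → ℝ) :
    ∃ v : PBond P j → ℝ,
      (∀ B : PBond P j → ℝ,
        ∑ p : Plaq P j, ((v (slotBond p 0) + v (slotBond p 1) - v (slotBond p 2) - v (slotBond p 3)) - w p) *
          (B (slotBond p 0) + B (slotBond p 1) - B (slotBond p 2) - B (slotBond p 3)) = 0) ∧
      ∑ p : Plaq P j, (v (slotBond p 0) + v (slotBond p 1) - v (slotBond p 2) - v (slotBond p 3)) ^ 2 ≤
        ∑ p : Plaq P j, w p ^ 2 := by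
  classical
  -- bond fields and plaquette functions as Euclidean vectors; the curl as a linear map
  let ofV : EuclideanSpace ℝ (PBond P j) → PBond P j → ℝ := fun x b => x b
  let T : EuclideanSpace ℝ (PBond P j) →ₗ[ℝ] EuclideanSpace ℝ (Plaq P j) :=
    { toFun := fun x => WithLp.toLp 2 fun p =>
        ofV x (slotBond p 0) + ofV x (slotBond p 1) - ofV x (slotBond p 2) - ofV x (slotBond p 3)
      map_add' := by
        intro x y
        ext p
        simp only [ofV, PiLp.add_apply]
        ring
      map_smul' := by
        intro c x
        ext p
        simp only [ofV, PiLp.smul_apply, smul_eq_mul, RingHom.id_apply]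
        ring }
  have T_apply : ∀ x (p : Plaq P j),
      T x p = ofV x (slotBond p 0) + ofV x (slotBond p 1) - ofV x (slotBond p 2) - ofV x (slotBond p 3) := fun x p => rfl
  let wE : EuclideanSpace ℝ (Plaq P j) := WithLp.toLp 2 fun p => w p
  have wE_apply : ∀ p, wE p = w p := fun p => rfl
  let K : Submodule ℝ (EuclideanSpace ℝ (Plaq P j)) := LinearMap.range T
  haveI : CompleteSpace K := FiniteDimensional.complete ℝ K
  obtain ⟨x, hx⟩ := LinearMap.mem_range.1 (K.starProjection_apply_mem wE)
  have horth : ∀ y, ⟪wE - T x, T y⟫ = 0 := by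
    intro y
    have hm := K.sub_starProjection_mem_orthogonal wE
    rw [← hx] at hm
    exact (Submodule.mem_orthogonal' _ _).1 hm _ (LinearMap.mem_range_self T y)
  have hnorm : ‖T x‖ ≤ ‖wE‖ := by
    rw [hx]
    exact K.norm_starProjection_apply_le wE
  have inner_eq : ∀ a b : EuclideanSpace ℝ (Plaq P j), ⟪a, b⟫ = ∑ p, a p * b p := by
    intro a b
    rw [PiLp.inner_apply]
    exact Finset.sum_congr rfl fun p _ => by simp [mul_comm]
  have norm_sq_eq : ∀ a : EuclideanSpace ℝ (Plaq P j), ‖a‖ ^ 2 = ∑ p, a p ^ 2 := by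
    intro a
    rw [EuclideanSpace.norm_eq, Real.sq_sqrt (Finset.sum_nonneg fun p _ => by positivity)]
    exact Finset.sum_congr rfl fun p _ => by rw [Real.norm_eq_abs, sq_abs]
  refine ⟨ofV x, fun B => ?_, ?_⟩
  · -- normal equations against `B`
    let y : EuclideanSpace ℝ (PBond P j) := WithLp.toLp 2 fun b => B b
    have hy : ∀ b, ofV y b = B b := fun b => rfl
    have h0 := horth y
    rw [inner_eq] at h0
    have : ∑ p : Plaq P j, ((ofV x (slotBond p 0) + ofV x (slotBond p 1) - ofV x (slotBond p 2) - ofV x (slotBond p 3)) - w p) *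
        (B (slotBond p 0) + B (slotBond p 1) - B (slotBond p 2) - B (slotBond p 3)) =
        -∑ p : Plaq P j, (wE - T x) p * T y p := by
      rw [← Finset.sum_neg_distrib]
      refine Finset.sum_congr rfl fun p _ => ?_
      rw [PiLp.sub_apply, wE_apply, T_apply, T_apply, hy, hy, hy, hy]
      ring
    rw [this, h0, neg_zero]
  · -- the projection is a contraction
    have h1 : ∑ p : Plaq P j, (ofV x (slotBond p 0) + ofV x (slotBond p 1) - ofV x (slotBond p 2) - ofV x (slotBond p 3)) ^ 2 =
        ‖T x‖ ^ 2 := by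
      rw [norm_sq_eq]
      exact Finset.sum_congr rfl fun p _ => by rw [T_apply]
    have h2 : ∑ p : Plaq P j, w p ^ 2 = ‖wE‖ ^ 2 := by
      rw [norm_sq_eq]
    rw [h1, h2]
    exact pow_le_pow_left₀ (norm_nonneg _) hnorm 2

/-- Under the normal equations, `Σ_p (dv)_p·(dv)_p = Σ_p w_p·(dv)_p` (test with `B := v`). [folklore] -/
theorem sum_curl_mul_curl_eq_sum_mul_curl (w : Plaq P j → ℝ) (v : PBond P j → ℝ)
    (hN : ∀ B : PBond P j → ℝ,
      ∑ p : Plaq P j, ((v (slotBond p 0) + v (slotBond p 1) - v (slotBond p 2) - v (slotBond p 3)) - w p) *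
        (B (slotBond p 0) + B (slotBond p 1) - B (slotBond p 2) - B (slotBond p 3)) = 0) :
    ∑ p : Plaq P j, (v (slotBond p 0) + v (slotBond p 1) - v (slotBond p 2) - v (slotBond p 3)) ^ 2 =
      ∑ p : Plaq P j, w p * (v (slotBond p 0) + v (slotBond p 1) - v (slotBond p 2) - v (slotBond p 3)) := by
  have h := hN v
  rw [← sub_eq_zero, ← Finset.sum_sub_distrib, ← h]
  refine Finset.sum_congr rfl fun p _ => ?_
  ring

/-- `Σ (a − b)² = Σ a² − 2 Σ a·b + Σ b²` (finite sums). [folklore] -/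
theorem sum_sub_sq_eq {ι : Type*} (s : Finset ι) (a b : ι → ℝ) :
    ∑ i ∈ s, (a i - b i) ^ 2 = ∑ i ∈ s, a i ^ 2 - 2 * ∑ i ∈ s, a i * b i + ∑ i ∈ s, b i ^ 2 := by
  rw [Finset.mul_sum, ← Finset.sum_sub_distrib, ← Finset.sum_add_distrib]
  exact Finset.sum_congr rfl fun i _ => by ring

/-- **PYTHAGORAS** for the projection: under the normal equations `Σ_p (w − dv)_p² = Σ_p w_p² − Σ_p (dv)_p²`. [folklore] -/
theorem sum_sq_sub_eq (w : Plaq P j → ℝ) (v : PBond P j → ℝ)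
    (hN : ∀ B : PBond P j → ℝ,
      ∑ p : Plaq P j, ((v (slotBond p 0) + v (slotBond p 1) - v (slotBond p 2) - v (slotBond p 3)) - w p) *
        (B (slotBond p 0) + B (slotBond p 1) - B (slotBond p 2) - B (slotBond p 3)) = 0) :
    ∑ p : Plaq P j, (w p - (v (slotBond p 0) + v (slotBond p 1) - v (slotBond p 2) - v (slotBond p 3))) ^ 2 =
      ∑ p : Plaq P j, w p ^ 2 -
        ∑ p : Plaq P j, (v (slotBond p 0) + v (slotBond p 1) - v (slotBond p 2) - v (slotBond p 3)) ^ 2 := by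
  have h := sum_curl_mul_curl_eq_sum_mul_curl w v hN
  rw [sum_sub_sq_eq Finset.univ w (fun p => v (slotBond p 0) + v (slotBond p 1) - v (slotBond p 2) - v (slotBond p 3)), ← h]
  ring

/-- ★ **THE RESIDUAL CARRIES THE WHOLE NET FLUX**: for ANY bond field `v` and weight `w`, `Σ_{p ∥ (μ,ν)} (w − dv)_p = Σ_{p ∥ (μ,ν)} w_p` — the exact
part `dv` has zero net flux through every orientation (✓`sum_ite_curl_eq_zero`), so the net flux of `w` lives entirely in `w − dv` (for the torus
least-squares potential: in the coexact-plus-harmonic part of `w`, spread over the whole torus). [folklore] -/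
theorem sum_ite_sub_curl_eq (w : Plaq P j → ℝ) (v : PBond P j → ℝ) {μ ν : Fin P.d} (h : μ < ν) :
    ∑ p : Plaq P j, (if p.μ = μ ∧ p.ν = ν then
        w p - (v (slotBond p 0) + v (slotBond p 1) - v (slotBond p 2) - v (slotBond p 3)) else 0) =
      ∑ p : Plaq P j, (if p.μ = μ ∧ p.ν = ν then w p else 0) := by
  have h0 := sum_ite_curl_eq_zero v h
  rw [← sub_eq_zero, ← Finset.sum_sub_distrib]
  rw [← neg_eq_zero, ← Finset.sum_neg_distrib, ← h0]
  refine Finset.sum_congr rfl fun p _ => ?_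
  split_ifs <;> ring

/-- **Componentwise (vector-valued) form**: for a weight with values in `Fin m → ℝ` one torus potential per component, each with its normal equations
and energy bound (e.g. the three `𝔰𝔲(2)` components `w ⊗ τ_α`). [cite: GrossCMP1983, Thm 2.2] -/
theorem exists_torus_leastSquares_potential_pi {m : ℕ} (w : Plaq P j → Fin m → ℝ) :
    ∃ v : Fin m → PBond P j → ℝ, ∀ k : Fin m,
      (∀ B : PBond P j → ℝ,
        ∑ p : Plaq P j, ((v k (slotBond p 0) + v k (slotBond p 1) - v k (slotBond p 2) - v k (slotBond p 3)) - w p k) *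
          (B (slotBond p 0) + B (slotBond p 1) - B (slotBond p 2) - B (slotBond p 3)) = 0) ∧
      ∑ p : Plaq P j, (v k (slotBond p 0) + v k (slotBond p 1) - v k (slotBond p 2) - v k (slotBond p 3)) ^ 2 ≤
        ∑ p : Plaq P j, w p k ^ 2 := by
  have hk := fun k : Fin m => exists_torus_leastSquares_potential (P := P) (j := j) fun p => w p k
  exact ⟨fun k => (hk k).choose, fun k => (hk k).choose_spec⟩

end Summit.QuantumFields.YangMills.Theorems.UnitScaleGibbsTorusLeastSquaresPotential

end
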